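import Mathlib
import HarnessLib
import Summits.NavierStokesRegularity.NavierStokesRegularity.Theorems.TaylorModelRungThreeSoundnessMajorant

/-!
# Line `taylor-model` on crux K1b-DR (`ExactWindowRungThree.DerivativeEnclosureCertificateR`,
# stmt-NavierStokesRegularity-23954) — stub S1 `stub_soundness`, helper 4: uniqueness and the global
# flow selector

Toward the registered stub `stub_soundness : TaylorModelSoundness` (skeleton v3 `9391589be9c875b2`,
line owner ns-idea-2 g3; Part C of `S1-PROOFPLAN.md`). For a system `IsMajorantSystem n Q w b T U`:

* sup-norm bookkeeping for positive weights (`abs_apply_le_norm_mul`, `norm_le_of_wbound`) and the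
  sup-norm bound of the field `‖Q u v‖ ≤ b (Σ w⁻¹)² (Σ w) ‖u‖ ‖v‖` (`norm_Q_le`);
* the quadratic field `u ↦ Q u u` is Lipschitz on every ball (`lipschitzOnWith_field`), hence two
  solutions on `[0,t]` from the same point coincide (`sol_unique`, Mathlib's Grönwall-based
  `ODE_solution_unique_of_mem_Icc_right`);
* the selector `flowSel Q` (`Theorems/TaylorModelRungThreeSoundnessDefs.lean`): `flowSel_zero`,
  `isSolOn_restrict`, and `flowSel_eq` — the selector agrees with EVERY solution on its interval;
* `exists_radius` (slack `r > t` with `b m r < 1`) and `pseries_T_zero` (the series starts at `x`).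

MODEL-lattice bookkeeping only (rung TL-M3 of the NS ladder); nothing here is a statement about the
Navier–Stokes equations.
-/

noncomputable section

-- the sub-problem namespace repeats the summit name by design (D-0017)
set_option linter.dupNamespace false

namespace Summit.NavierStokesRegularity.NavierStokesRegularity.Theorems.TaylorModelMajorant

open scoped BigOperators Topology
open Finset Set Filter

/-! ### Sup-norm bookkeeping for positive weights -/

section Norms

variable {n : ℕ} {w : Fin n → ℝ}

/-- `|u_c| ≤ ‖u‖ · (Σ_c' w_c'⁻¹) · w_c` — every vector is weighted-bounded with radius `‖u‖ Σ w⁻¹`.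
[folklore] -/
theorem abs_apply_le_norm_mul (hw : ∀ c, 0 < w c) (u : Fin n → ℝ) (c : Fin n) :
    |u c| ≤ ‖u‖ * (∑ c', (w c')⁻¹) * w c := by
  have h1 : |u c| ≤ ‖u‖ := by rw [← Real.norm_eq_abs]; exact norm_le_pi_norm u c
  have h2 : (1 : ℝ) ≤ (∑ c', (w c')⁻¹) * w c := by
    have : (w c)⁻¹ ≤ ∑ c', (w c')⁻¹ :=
      Finset.single_le_sum (f := fun c' => (w c')⁻¹) (fun c' _ => (inv_pos.2 (hw c')).le)
        (Finset.mem_univ c)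
    calc (1 : ℝ) = (w c)⁻¹ * w c := by rw [inv_mul_cancel₀ (hw c).ne']
      _ ≤ (∑ c', (w c')⁻¹) * w c := mul_le_mul_of_nonneg_right this (hw c).le
  calc |u c| ≤ ‖u‖ * 1 := by rw [mul_one]; exact h1
    _ ≤ ‖u‖ * ((∑ c', (w c')⁻¹) * w c) := mul_le_mul_of_nonneg_left h2 (norm_nonneg _)
    _ = _ := by ring

/-- A weighted bound of radius `N ≥ 0` gives the sup-norm bound `‖u‖ ≤ N · Σ_c w_c`. [folklore] -/
theorem norm_le_of_wbound (hw : ∀ c, 0 < w c) {u : Fin n → ℝ} {N : ℝ} (hN : 0 ≤ N)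
    (hu : ∀ c, |u c| ≤ N * w c) : ‖u‖ ≤ N * ∑ c', w c' := by
  have hWp : 0 ≤ ∑ c', w c' := Finset.sum_nonneg fun c' _ => (hw c').le
  refine (pi_norm_le_iff_of_nonneg (mul_nonneg hN hWp)).2 fun c => ?_
  rw [Real.norm_eq_abs]
  calc |u c| ≤ N * w c := hu c
    _ ≤ N * ∑ c', w c' := mul_le_mul_of_nonneg_left
        (Finset.single_le_sum (f := fun c' => w c') (fun c' _ => (hw c').le) (Finset.mem_univ c)) hN

end Norms

/-! ### Solutions on `[0,t]`: restriction and the selector at time `0` -/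

section Sol

variable {n : ℕ} {Q : (Fin n → ℝ) → (Fin n → ℝ) → Fin n → ℝ}

/-- A solution on `[0,t]` restricts to a solution on `[0,s]`, `s ∈ [0,t]`. [folklore] -/
theorem isSolOn_restrict {x : Fin n → ℝ} {t s : ℝ} {ψ : ℝ → Fin n → ℝ} (hψ : IsSolOn Q x t ψ)
    (hs : s ∈ Set.Icc 0 t) : IsSolOn Q x s ψ :=
  ⟨hψ.1, fun r hr => (hψ.2 r ⟨hr.1, hr.2.trans hs.2⟩).mono (Set.Icc_subset_Icc_right hs.2)⟩

/-- `flowSel Q x 0 = x` (a solution on `[0,0]` starts at `x`; otherwise the junk value is `x`).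
[folklore] -/
theorem flowSel_zero (x : Fin n → ℝ) : flowSel Q x 0 = x := by
  by_cases hex : ∃ ψ, IsSolOn Q x 0 ψ
  · rw [flowSel, dif_pos hex]
    exact hex.choose_spec.1
  · rw [flowSel, dif_neg hex]

end Sol

variable {n : ℕ} {Q : (Fin n → ℝ) → (Fin n → ℝ) → Fin n → ℝ} {w : Fin n → ℝ} {b : ℝ}
  {T : (Fin n → ℝ) → ℕ → Fin n → ℝ} {U : (Fin n → ℝ) → (Fin n → ℝ) → ℕ → Fin n → ℝ}

namespace IsMajorantSystem

variable (h : IsMajorantSystem n Q w b T U)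
include h

/-! ### The field is Lipschitz on bounded sets; uniqueness of solutions -/

/-- **Sup-norm bound of the field**: `‖Q u v‖ ≤ b (Σ w⁻¹)² (Σ w) ‖u‖ ‖v‖`. [folklore] -/
theorem norm_Q_le (u v : Fin n → ℝ) :
    ‖Q u v‖ ≤ b * (∑ c, (w c)⁻¹) ^ 2 * (∑ c, w c) * ‖u‖ * ‖v‖ := by
  have hb := h.b_nonneg
  have hWm : 0 ≤ ∑ c, (w c)⁻¹ := Finset.sum_nonneg fun c _ => (inv_pos.2 (h.w_pos c)).le
  have hu := abs_apply_le_norm_mul h.w_pos u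
  have hv := abs_apply_le_norm_mul h.w_pos v
  have hQ : ∀ c, |Q u v c| ≤ b * (‖u‖ * ∑ c, (w c)⁻¹) * (‖v‖ * ∑ c, (w c)⁻¹) * w c :=
    fun c => h.bound' hu hv c
  have key := norm_le_of_wbound h.w_pos (by positivity) hQ
  calc ‖Q u v‖ ≤ b * (‖u‖ * ∑ c, (w c)⁻¹) * (‖v‖ * ∑ c, (w c)⁻¹) * ∑ c, w c := key
    _ = _ := by ring

/-- **The quadratic field is Lipschitz on every ball**: on `closedBall 0 R` the map `u ↦ Q u u` is
Lipschitz with constant `2 b (Σ w⁻¹)² (Σ w) R`. [folklore] -/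
theorem lipschitzOnWith_field {R : ℝ} (hR : 0 ≤ R) :
    LipschitzOnWith (Real.toNNReal (2 * (b * (∑ c, (w c)⁻¹) ^ 2 * (∑ c, w c)) * R))
      (fun u => Q u u) (Metric.closedBall 0 R) := by
  have hb := h.b_nonneg
  have hWp : 0 ≤ ∑ c, w c := Finset.sum_nonneg fun c _ => (h.w_pos c).le
  set C := b * (∑ c, (w c)⁻¹) ^ 2 * (∑ c, w c) with hC
  have hC0 : 0 ≤ C := by positivity
  refine LipschitzOnWith.of_dist_le_mul fun u hu v hv => ?_
  rw [Real.coe_toNNReal _ (by positivity), dist_eq_norm, dist_eq_norm]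
  have hu' : ‖u‖ ≤ R := mem_closedBall_zero_iff.1 hu
  have hv' : ‖v‖ ≤ R := mem_closedBall_zero_iff.1 hv
  have e : Q u u - Q v v = Q (u - v) u + Q v (u - v) := by
    rw [h.Q_sub_left, h.Q_sub_right]
    abel
  rw [e]
  calc ‖Q (u - v) u + Q v (u - v)‖ ≤ ‖Q (u - v) u‖ + ‖Q v (u - v)‖ := norm_add_le _ _
    _ ≤ C * ‖u - v‖ * ‖u‖ + C * ‖v‖ * ‖u - v‖ := add_le_add (h.norm_Q_le _ _) (h.norm_Q_le _ _)
    _ ≤ C * ‖u - v‖ * R + C * R * ‖u - v‖ := by gcongr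
    _ = 2 * C * R * ‖u - v‖ := by ring

/-- **Uniqueness**: two solutions of `u' = Q(u,u)` on `[0,t]` from the same point coincide on `[0,t]`
(Grönwall, Mathlib `ODE_solution_unique_of_mem_Icc_right`, with the Lipschitz constant of the ball
containing both compact trajectories). [folklore] -/
theorem sol_unique {x : Fin n → ℝ} {t : ℝ} {ψ χ : ℝ → Fin n → ℝ} (hψ : IsSolOn Q x t ψ)
    (hχ : IsSolOn Q x t χ) : Set.EqOn ψ χ (Set.Icc 0 t) := by
  have hψc : ContinuousOn ψ (Set.Icc 0 t) := fun s hs => (hψ.2 s hs).continuousWithinAt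
  have hχc : ContinuousOn χ (Set.Icc 0 t) := fun s hs => (hχ.2 s hs).continuousWithinAt
  obtain ⟨Cψ, hCψ⟩ := isCompact_Icc.exists_bound_of_continuousOn hψc
  obtain ⟨Cχ, hCχ⟩ := isCompact_Icc.exists_bound_of_continuousOn hχc
  set R := max (max Cψ Cχ) 0 with hRdef
  have hR : 0 ≤ R := le_max_right _ _
  have hK := h.lipschitzOnWith_field hR
  have hnhds : ∀ s ∈ Set.Ico (0 : ℝ) t, Set.Icc 0 t ∈ 𝓝[≥] s := fun s hs =>
    mem_of_superset (Icc_mem_nhdsGE hs.2) (Set.Icc_subset_Icc_left hs.1)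
  exact ODE_solution_unique_of_mem_Icc_right (v := fun _ u => Q u u)
    (s := fun _ => Metric.closedBall 0 R) (fun _ _ => hK) hψc
    (fun s hs => (hψ.2 s (Set.Ico_subset_Icc_self hs)).mono_of_mem_nhdsWithin (hnhds s hs))
    (fun s hs => mem_closedBall_zero_iff.2
      ((hCψ s (Set.Ico_subset_Icc_self hs)).trans ((le_max_left _ _).trans (le_max_left _ _))))
    hχc
    (fun s hs => (hχ.2 s (Set.Ico_subset_Icc_self hs)).mono_of_mem_nhdsWithin (hnhds s hs))
    (fun s hs => mem_closedBall_zero_iff.2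
      ((hCχ s (Set.Ico_subset_Icc_self hs)).trans ((le_max_right _ _).trans (le_max_left _ _))))
    (hψ.1.trans hχ.1.symm)

/-- **The selector is every solution**: if `ψ` solves on `[0,t]` from `x` then `flowSel Q x s = ψ s`
for all `s ∈ [0,t]`. [folklore] -/
theorem flowSel_eq {x : Fin n → ℝ} {t : ℝ} {ψ : ℝ → Fin n → ℝ} (hψ : IsSolOn Q x t ψ) {s : ℝ}
    (hs : s ∈ Set.Icc 0 t) : flowSel Q x s = ψ s := by
  have hex : ∃ χ, IsSolOn Q x s χ := ⟨ψ, isSolOn_restrict hψ hs⟩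
  rw [flowSel, dif_pos hex]
  exact h.sol_unique hex.choose_spec (isSolOn_restrict hψ hs) ⟨hs.1, le_rfl⟩

/-! ### The Taylor series is a solution on `[0,t]` whenever `b m t < 1` -/

/-- A radius `r > t` with `b m r < 1` (the series converges on an open interval beyond `t`).
[folklore] -/
theorem exists_radius {m t : ℝ} (hm : 0 ≤ m) (ht : 0 ≤ t) (hq : b * m * t < 1) :
    ∃ r, t < r ∧ 0 < r ∧ b * m * r < 1 := by
  have hbm : 0 ≤ b * m := mul_nonneg h.b_nonneg hm
  set δ := (1 - b * m * t) / (b * m + 1) with hδ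
  have hδ0 : 0 < δ := div_pos (by linarith) (by linarith)
  refine ⟨t + δ, by linarith, by linarith, ?_⟩
  have key : b * m * δ < 1 - b * m * t := by
    have e : b * m * δ = (b * m / (b * m + 1)) * (1 - b * m * t) := by
      rw [hδ]
      field_simp
    rw [e]
    exact mul_lt_of_lt_one_left (by linarith) ((div_lt_one (by linarith)).2 (by linarith))
  nlinarith

/-- The series starts at `x`: `Σ_k T x k 0^k = T x 0 = x`. [folklore] -/
theorem pseries_T_zero (x : Fin n → ℝ) : pseries (T x) 0 = x := by
  funext c
  simp only [pseries]
  rw [tsum_eq_single 0 (fun k hk => by rw [zero_pow hk, mul_zero])]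
  simp [h.T_zero]

end IsMajorantSystem

end Summit.NavierStokesRegularity.NavierStokesRegularity.Theorems.TaylorModelMajorant

end
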